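import Mathlib
import Summits.Ventures.PercRepro.TriangleCapFourRowTwo

/-!
# PercRepro — THE HUNG `K_{3,k−4}` (`HungK3`): a vertex of degree `2` on an edge of `K_{3,k−4}` lies on the cell
`(k, 3, 1)` at the second-best value `m k − (k − 2) − 2 (k − 7)` and is `3`-bipartite for no `A`; the degrees of a
complete bipartite `BipSub`; the one-end count on an edge of `N(x)` for a general set `R` (p3, gen 45; part 200a)

The census says the second-best graphs of the cell `(k, 3, 1)` are EXACTLY the hung `K_{3,k−4}`
(`3,360 = 8 · 35 · 12` at `(8, 14)`, `7,560` at `(9, 17)`, `15,120` at `(10, 20)`); part 200b proves it for `k ≥ 10`.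
`deg_of_bipSub_full`: in a `BipSub` with all cross pairs a vertex of `A` has degree `k − a`, one off `A` has degree
`a`. `nbhd_del_eq_pair`: the neighbourhood of a vertex of degree `2`. `hungK3_value`: the cell, the value, never
`BipSub` (the triangle `z x y`). `degIn_add_degIn_le_card_of_nbhd_edge`: on an edge `y y′` of `N(x)`, each `u ∈ R`
(`u ≠ x`) is adjacent to at most one end. Axioms: standard.
-/

namespace PercRepro

namespace TriangleCap

namespace C047

open Finset

variable {V : Type*} [Fintype V] [DecidableEq V]

/-- **THE HUNG `K_{3,k−4}`:** a vertex `z` of degree `2` whose deletion is `K_{3,k−4}` (a spanning subgraph of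
`K(A, Aᶜ)`, `|A| = 3`, with `3 (k − 4)` edges), the two neighbours of `z` on opposite sides. -/
def HungK3 (D : SimpleGraph V) [DecidableRel D.Adj] : Prop :=
  ∃ (z : V) (A : Finset {v : V // v ≠ z}), deg D z = 2 ∧ A.card = 3 ∧ BipSub (del D z) A ∧
    (del D z).edgeFinset.card = 3 * (Fintype.card {v : V // v ≠ z} - 3) ∧
    ∃ x y : {v : V // v ≠ z}, x ∈ A ∧ y ∉ A ∧ D.Adj x.1 z ∧ D.Adj y.1 z

/-- In a complete bipartite `BipSub` (`|E| = a (k − a)`), a vertex of `A` has degree `k − a` and a vertex off `A`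
has degree `a`. -/
theorem deg_of_bipSub_full (H : SimpleGraph V) [DecidableRel H.Adj] (A : Finset V) (hA : BipSub H A) (a : ℕ)
    (hAcard : A.card = a) (hm : H.edgeFinset.card = a * (Fintype.card V - a)) (x : V) :
    deg H x = if x ∈ A then Fintype.card V - a else a := by
  by_cases hx : x ∈ A
  · rw [if_pos hx]
    apply le_antisymm
    · have := deg_le_of_bipSub_mem H A hA x hx
      rw [hAcard] at this
      exact this
    · unfold deg
      have hsub : Aᶜ ⊆ univ.filter (fun w => H.Adj x w) := by
        intro y hy
        rw [mem_compl] at hy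
        rw [mem_filter]
        exact ⟨mem_univ y, adj_of_bipSub_full H A hA a hAcard hm hx hy⟩
      have := card_le_card hsub
      rw [card_compl, hAcard] at this
      exact this
  · rw [if_neg hx]
    apply le_antisymm
    · have := deg_le_card_of_bipSub H A hA x hx
      rw [hAcard] at this
      exact this
    · unfold deg
      have hsub : A ⊆ univ.filter (fun w => H.Adj x w) := by
        intro y hy
        rw [mem_filter]
        exact ⟨mem_univ y, H.adj_symm (adj_of_bipSub_full H A hA a hAcard hm hy hx)⟩
      have := card_le_card hsub
      rw [hAcard] at this
      exact this

/-- The neighbourhood of a vertex of degree `2` with two distinct neighbours `x ≠ y` is `{x, y}` (in `D − z`). -/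
theorem nbhd_del_eq_pair (D : SimpleGraph V) [DecidableRel D.Adj] (z : V) (hz : deg D z = 2)
    (x y : {v : V // v ≠ z}) (hxy : x ≠ y) (hx : D.Adj x.1 z) (hy : D.Adj y.1 z) :
    univ.filter (fun w : {v : V // v ≠ z} => D.Adj w.1 z) = {x, y} := by
  symm
  apply eq_of_subset_of_card_le
  · intro w hw
    rw [mem_insert, mem_singleton] at hw
    rw [mem_filter]
    rcases hw with rfl | rfl
    · exact ⟨mem_univ _, hx⟩
    · exact ⟨mem_univ _, hy⟩
  · rw [card_nbhd_del, hz, card_pair hxy]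

/-- **THE VALUE OF THE HUNG `K_{3,k−4}`:** for `8 ≤ k`, a `HungK3` graph has `3 (k − 3) − 1` edges,
`Σ_v d(v)² + (k − 2) + 2 (k − 7) = m k`, and is a spanning subgraph of no `K(A, Aᶜ)`. -/
theorem hungK3_value (D : SimpleGraph V) [DecidableRel D.Adj] (hk : 8 ≤ Fintype.card V) (hH : HungK3 D) :
    D.edgeFinset.card + 1 = 3 * (Fintype.card V - 3) ∧
      ∑ v, deg D v * deg D v + (Fintype.card V - 2) + 2 * (Fintype.card V - 7) =
        D.edgeFinset.card * Fintype.card V ∧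
      ∀ B : Finset V, ¬ BipSub D B := by
  obtain ⟨z, A, hz, hA, hB, hE, x, y, hxA, hyA, hxz, hyz⟩ := hH
  have hcard' := card_del z
  have hedges' := card_edges_del D z
  have hsq := sum_deg_sq_del D z
  rw [hz] at hedges' hsq
  have hxy : x ≠ y := fun h => hyA (h ▸ hxA)
  have hxyadj : (del D z).Adj x y := adj_of_bipSub_full (del D z) A hB 3 hA hE hxA hyA
  have hdx := deg_of_bipSub_full (del D z) A hB 3 hA hE x
  have hdy := deg_of_bipSub_full (del D z) A hB 3 hA hE y
  rw [if_pos hxA] at hdx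
  rw [if_neg hyA] at hdy
  have hT : ∑ w : {v : V // v ≠ z}, (if D.Adj w.1 z then deg (del D z) w else 0) =
      Fintype.card {v : V // v ≠ z} - 3 + 3 := by
    rw [← sum_filter, nbhd_del_eq_pair D z hz x y hxy hxz hyz, sum_pair hxy, hdx, hdy]
  haveI : Nonempty {v : V // v ≠ z} := Fintype.card_pos_iff.mp (by omega)
  have hS' := sum_deg_sq_eq_of_bipSub_full (del D z) A 3 hA hB hE inferInstance
  refine ⟨by omega, ?_, ?_⟩
  · rw [hsq, hT, hS', hE]
    obtain ⟨k, hk'⟩ : ∃ k, Fintype.card V = k := ⟨_, rfl⟩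
    have e : Fintype.card {v : V // v ≠ z} = k - 1 := by omega
    rw [hE, e] at hedges'
    rw [e, hk']
    obtain ⟨t, rfl⟩ : ∃ t, k = t + 8 := ⟨k - 8, by omega⟩
    have e1 : t + 8 - 1 - 3 = t + 4 := by omega
    have e2 : t + 8 - 1 = t + 7 := by omega
    have e3 : t + 8 - 2 = t + 6 := by omega
    have e4 : t + 8 - 7 = t + 1 := by omega
    rw [e1, e2, e3, e4]
    rw [e1] at hedges'
    have : D.edgeFinset.card = 3 * (t + 4) + 2 := by omega
    rw [this]
    ring
  · intro B hBip
    -- the triangle `z x y`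
    have h1 := hBip x.1 z hxz
    have h2 := hBip y.1 z hyz
    have h3 := hBip x.1 y.1 (by
      have := hxyadj
      unfold del at this
      exact this)
    tauto

/-- `degIn R y + degIn R y' ≤ |R|` for an edge `y y'` inside `N(x)` and `R` off `x`: each `u ∈ R` is adjacent to
at most one of `y, y'`. -/
theorem degIn_add_degIn_le_card_of_nbhd_edge (D : SimpleGraph V) [DecidableRel D.Adj] (hK : K4mFree D) (x : V)
    (R : Finset V) (hR : ∀ u ∈ R, u ≠ x) {y y' : V} (hy : D.Adj x y) (hy' : D.Adj x y') (hyy' : D.Adj y y') :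
    degIn D R y + degIn D R y' ≤ R.card := by
  unfold degIn
  have hdisj : Disjoint (R.filter (fun u => D.Adj y u)) (R.filter (fun u => D.Adj y' u)) := by
    rw [disjoint_left]
    intro u hu1 hu2
    rw [mem_filter] at hu1 hu2
    exact not_adj_both D hK hyy' (D.adj_symm hy) (D.adj_symm hy') (hR u hu1.1).symm hu1.2 hu2.2
  have h := card_union_add_card_inter (R.filter (fun u => D.Adj y u)) (R.filter (fun u => D.Adj y' u))
  rw [disjoint_iff_inter_eq_empty.mp hdisj, card_empty, add_zero] at h
  have hsub : (R.filter (fun u => D.Adj y u)) ∪ (R.filter (fun u => D.Adj y' u)) ⊆ R :=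
    union_subset (filter_subset _ _) (filter_subset _ _)
  have := card_le_card hsub
  omega

end C047

end TriangleCap

end PercRepro
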